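import Summits.ValiantsHypothesis.ValiantsHypothesis.Theorems.BarrierLeverPartitionMinorsHitByVPSamePatternDefs

/-!
# Route BarrierLever — item `PartitionMinorsHitByVP` (stmt-ValiantsHypothesis-19717):
# «SAME COMPLEX ON BOTH SIDES» — the Moore determinant of `Δ × Δ` is nonzero for EVERY simplicial complex `Δ`

Helper file (`--supports stmt-ValiantsHypothesis-19717`; cell valiant-natproofs, rung V4, 𝒟-side door (c); prover
seat val-np-p6 gen 6). Definition-free (objects in `…SamePatternDefs`). Closes NO item. Generalises `…HitByVPMooreBallBall`
(ball × ball ↦ Δ × Δ for any down-closed family Δ).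

THE OBSERVATION. The low-order peel of `…MooreBallBall` needs, on the ROW side, only that the row family `R` is
down-closed (then `R = del ⊔ (★ + link)` with `link ⊆ del`, so the row of `S' ∪ {★}` can be differenced against the row
of `S'`), and on the COLUMN side only that the columns containing the LOWEST digit are exactly as many as `|link|`
(«no tie»; their tails are then automatically distinct). If rows and columns run through the SAME down-closed family `Δ`
(node `a` ↔ digit `a`) and we peel the node of the lowest digit, both conditions hold with `(del, link)` on both sides,
and the two Pascal pieces are again of the form `Δ' × Δ'` (`Δ' = del Δ`, `link Δ`, both down-closed). Induction on the
number of vertices: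

* `spMatrix_det_ne_zero_peel` — `det(Δ × Δ) ≠ 0 ⇐ det(del × del) ≠ 0 ∧ det(link × link) ≠ 0` (digit exponents shifted);
* **`spMatrix_det_ne_zero`** — for every prime `p`, every `n`, every strictly increasing digit-exponent map and EVERY
  down-closed family `Δ ⊆ 2^{Fin n}`: `det [η_S^{Σ_{c∈T} p^{d c}}]_{S,T ∈ Δ} ≠ 0` in `𝔽_p[Y]`;
* `frobDet_ne_zero_samePattern_lowerSet` — the same for arbitrary enumerations `u, w : Fin r → Finset (Fin h)` with
  `Set.range u = Set.range w` a lower set (the hypotheses of the item, `𝔽_p[Y_none, Y_some a]` variables);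
* `additiveTable_samePattern_lowerSet` (a numeric complex additive table exists — T1 on these layouts) and
  **`partitionMinor_hit_samePattern_lowerSet`**: `h ≥ 2`, rows and columns running through the same simplicial complex
  (in any two orders) ⇒ hit inside `SmallCircuits ℂ (h+h) 5`.
The companion `…SamePatternAll` removes «lower set» by val-np-p1 g12's compression (rows and columns compressed
simultaneously keep equal ranges): EVERY layout with `Set.range u = Set.range w` — in particular every PRINCIPAL MINOR of
the partition matrix, of every size — is hit (`SmallCircuits ℂ (h+h) 9`).

WHAT THIS IS NOT: the columns must run through the same set family as the rows; T1 / F_3 for independent row and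
column families stay OPEN; nothing on crux 14610 or VP vs VNP.
-/

set_option linter.dupNamespace false

namespace Summit.ValiantsHypothesis.ValiantsHypothesis.Theorems.BarrierLever.FrobeniusDoor

open Finset MvPolynomial Matrix
open Literature.Barriers.ValiantsHypothesis

noncomputable section

variable (p : ℕ)

section Peel
variable [Fact p.Prime]

/-- **THE PEEL STEP for a down-closed family.** If `d 0 < d c` for all `c ≠ 0` and both Pascal pieces `BB(n, e+1)`, `BB(n, e)` (for the shifted
digit exponents `d ∘ succ`) have nonzero determinant, then so has `BB(n+1, e+1)` (for `d`). Mechanism: reindex by the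
split at node `0`, pass to `R[T]` (`T = Y_0`-node variable via `finSuccEquiv`), subtract from each row `S' ∪ {0}` the row `S'`;
then every entry of the bottom blocks is divisible by `T^(p^(d 0))`, exactly (bottom-left: by `T^(p^(d 0 + 1))`; bottom-right:
`T^(p^(d 0)) · (BB(n,e) + T·G)`), so `det = T^(q·|B(n,e)|) · det Q` with `Q(0)` block-triangular with diagonal blocks
`BB(n,e+1)` and `BB(n,e)`. -/
theorem spMatrix_det_ne_zero_peel (n : ℕ) (F : Finset (Finset (Fin (n + 1)))) (hF : IsDownClosedFam F)
    (d : Fin (n + 1) → ℕ) (hd : ∀ c : Fin n, d 0 < d c.succ)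
    (hA : (spMatrix p n (d ∘ Fin.succ) (famDel F)).det ≠ 0) (hB : (spMatrix p n (d ∘ Fin.succ) (famLink F)).det ≠ 0) :
    (spMatrix p (n + 1) d F).det ≠ 0 := by
  classical
  -- abbreviations
  set R := MvPolynomial (Fin (n + 1)) (ZMod p) with hR
  set ψ := MvPolynomial.finSuccEquiv (ZMod p) (n + 1) with hψ
  set d' : Fin n → ℕ := d ∘ Fin.succ with hd'
  set q : ℕ := p ^ d 0 with hq
  set A : Matrix (Fam (famDel F)) (Fam (famDel F)) R := spMatrix p n d' (famDel F) with hAdef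
  set B : Matrix (Fam (famLink F)) (Fam (famLink F)) R := spMatrix p n d' (famLink F) with hBdef
  set A₁₂ : Matrix (Fam (famDel F)) (Fam (famLink F)) R :=
    Matrix.of fun S' W' => ballEta p n S'.1 ^ (q + ballWt p n d' W'.1) with hA₁₂
  set σ := famSplit F with hσ
  set M := spMatrix p (n + 1) d F with hM
  -- the reindexed matrix, mapped to `R[T]`
  set PM : Matrix (Fam (famDel F) ⊕ Fam (famLink F)) (Fam (famDel F) ⊕ Fam (famLink F)) (Polynomial R) :=
    ψ.toRingEquiv.toRingHom.mapMatrix (Matrix.reindex σ σ M) with hPM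
  have hdetPM : PM.det = ψ M.det := by
    rw [hPM, ← RingHom.map_det, Matrix.det_reindex_self]; rfl
  -- its four blocks
  set P₁₁ : Matrix (Fam (famDel F)) (Fam (famDel F)) (Polynomial R) := A.map Polynomial.C with hP₁₁
  set P₁₂ : Matrix (Fam (famDel F)) (Fam (famLink F)) (Polynomial R) := A₁₂.map Polynomial.C with hP₁₂
  set P₂₁ : Matrix (Fam (famLink F)) (Fam (famDel F)) (Polynomial R) :=
    Matrix.of fun S' V' => (Polynomial.X + Polynomial.C (ballEta p n S'.1)) ^ ballWt p n d' V'.1 with hP₂₁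
  set P₂₂ : Matrix (Fam (famLink F)) (Fam (famLink F)) (Polynomial R) :=
    Matrix.of fun S' W' => (Polynomial.X + Polynomial.C (ballEta p n S'.1)) ^ (q + ballWt p n d' W'.1) with hP₂₂
  have hentry : ∀ i j, PM i j = ψ (ballEta p (n + 1) (σ.symm i).1 ^ ballWt p (n + 1) d (σ.symm j).1) := by
    intro i j
    simp only [hPM, RingHom.mapMatrix_apply, Matrix.map_apply, Matrix.reindex_apply, Matrix.submatrix_apply, hM,
      spMatrix, Matrix.of_apply]
    rfl
  have hψX : ψ (X 0) = Polynomial.X := by rw [hψ]; exact MvPolynomial.finSuccEquiv_X_zero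
  have hblocks : PM = Matrix.fromBlocks P₁₁ P₁₂ P₂₁ P₂₂ := by
    refine Matrix.ext fun i j => ?_
    rw [hentry]
    rcases i with S' | S' <;> rcases j with V' | V'
    · rw [Matrix.fromBlocks_apply₁₁, hP₁₁, Matrix.map_apply, hAdef, spMatrix, Matrix.of_apply, hσ,
        famSplit_symm_inl, famSplit_symm_inl, ballEta_map_succEmb, ballWt_map_succEmb, map_pow,
        finSuccEquiv_rename_succ, ← map_pow]
    · rw [Matrix.fromBlocks_apply₁₂, hP₁₂, Matrix.map_apply, hA₁₂, Matrix.of_apply, hσ, famSplit_symm_inl,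
        famSplit_symm_inr, ballEta_map_succEmb, ballWt_insert_zero, map_pow, finSuccEquiv_rename_succ, ← map_pow]
    · rw [Matrix.fromBlocks_apply₂₁, hP₂₁, Matrix.of_apply, hσ, famSplit_symm_inr, famSplit_symm_inl,
        ballEta_insert_zero, ballWt_map_succEmb, map_pow, map_add, hψX, finSuccEquiv_rename_succ]
    · rw [Matrix.fromBlocks_apply₂₂, hP₂₂, Matrix.of_apply, hσ, famSplit_symm_inr, famSplit_symm_inr,
        ballEta_insert_zero, ballWt_insert_zero, map_pow, map_add, hψX, finSuccEquiv_rename_succ]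
  -- row differencing: subtract row `S'` (top block) from row `S' ∪ {0}` (bottom block)
  set E : Matrix (Fam (famLink F)) (Fam (famDel F)) (Polynomial R) :=
    Matrix.of fun S' T' => if T' = famLinkIncl hF S' then 1 else 0 with hE
  have hEmul' : ∀ {κ : Type} (N : Matrix (Fam (famDel F)) κ (Polynomial R)) S' j,
      (E * N) S' j = N (famLinkIncl hF S') j := by
    intro κ N S' j
    rw [Matrix.mul_apply, Finset.sum_eq_single (famLinkIncl hF S')]
    · simp [hE]
    · intro T' _ hT'; simp [hE, hT']
    · intro h; exact absurd (Finset.mem_univ _) h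
  set L : Matrix (Fam (famDel F) ⊕ Fam (famLink F)) (Fam (famDel F) ⊕ Fam (famLink F)) (Polynomial R) :=
    Matrix.fromBlocks 1 0 (-E) 1 with hL
  have hdetL : L.det = 1 := by rw [hL, Matrix.det_fromBlocks_zero₁₂, Matrix.det_one, Matrix.det_one, mul_one]
  have hLP : L * PM = Matrix.fromBlocks P₁₁ P₁₂ (P₂₁ - E * P₁₁) (P₂₂ - E * P₁₂) := by
    rw [hblocks, hL, Matrix.fromBlocks_multiply]
    simp only [Matrix.one_mul, Matrix.zero_mul, add_zero, Matrix.neg_mul]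
    congr 1 <;> abel
  -- divisibility of the differenced bottom blocks
  have hdvd : ∀ W' : Finset (Fin n), p ^ (d 0 + 1) ∣ ballWt p n d' W' := pow_succ_dvd_ballWt p n d hd
  have h21 : ∀ S' V', ∃ g : Polynomial R, (P₂₁ - E * P₁₁) S' V' = Polynomial.X ^ q * (Polynomial.X * g) := by
    intro S' V'
    obtain ⟨g₀, hg₀⟩ := X_pow_dvd_add_pow_sub p (R := R) (d 0) _ (hdvd V'.1) (ballEta p n S'.1)
    have h1 : p ^ d 0 + 1 ≤ p ^ (d 0 + 1) := Nat.pow_lt_pow_right (Fact.out : p.Prime).one_lt (by omega)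
    obtain ⟨r, hr⟩ := Nat.exists_eq_add_of_le h1
    rw [hr] at hg₀
    refine ⟨Polynomial.X ^ r * g₀, ?_⟩
    rw [Matrix.sub_apply, hEmul', hP₂₁, hP₁₁, Matrix.of_apply, Matrix.map_apply, hAdef, spMatrix, Matrix.of_apply]
    show _ - Polynomial.C (ballEta p n S'.1 ^ ballWt p n d' V'.1) = _
    rw [hg₀, hq]; ring
  have h22 : ∀ S' W', ∃ g : Polynomial R,
      (P₂₂ - E * P₁₂) S' W' = Polynomial.X ^ q * (Polynomial.C (B S' W') + Polynomial.X * g) := by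
    intro S' W'
    obtain ⟨g, hg⟩ := add_pow_sub_eq_X_pow_mul p (R := R) (d 0) _ (hdvd W'.1) (ballEta p n S'.1)
    refine ⟨g, ?_⟩
    rw [Matrix.sub_apply, hEmul', hP₂₂, hP₁₂, Matrix.of_apply, Matrix.map_apply, hA₁₂, Matrix.of_apply, hBdef, spMatrix,
      Matrix.of_apply]
    exact hg
  choose H hH using h21
  choose G hG using h22
  set Q : Matrix (Fam (famDel F) ⊕ Fam (famLink F)) (Fam (famDel F) ⊕ Fam (famLink F)) (Polynomial R) :=
    Matrix.fromBlocks P₁₁ P₁₂ (Matrix.of fun S' V' => Polynomial.X * H S' V')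
      (B.map Polynomial.C + Matrix.of fun S' W' => Polynomial.X * G S' W') with hQ
  have hfactor : L * PM = Matrix.fromBlocks 1 0 0 ((Polynomial.X : Polynomial R) ^ q • (1 : Matrix (Fam (famLink F)) (Fam (famLink F)) _)) * Q := by
    rw [hLP, hQ, Matrix.fromBlocks_multiply]
    simp only [Matrix.one_mul, Matrix.zero_mul, add_zero, zero_add, Matrix.smul_mul, Matrix.one_mul]
    congr 1
    · ext S' V'; rw [hH, Matrix.smul_apply, Matrix.of_apply, smul_eq_mul]
    · ext S' W'; rw [hG, Matrix.smul_apply, Matrix.add_apply, Matrix.map_apply, Matrix.of_apply, smul_eq_mul]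
  have hdetQ0 : (Polynomial.evalRingHom (0 : R)) Q.det = A.det * B.det := by
    rw [RingHom.map_det]
    have hQ0 : (Polynomial.evalRingHom (0 : R)).mapMatrix Q = Matrix.fromBlocks A A₁₂ 0 B := by
      refine Matrix.ext fun i j => ?_
      rw [RingHom.mapMatrix_apply, Matrix.map_apply, hQ]
      rcases i with S' | S' <;> rcases j with V' | V'
      · simp [hP₁₁]
      · simp [hP₁₂]
      · simp
      · simp
    rw [hQ0, Matrix.det_fromBlocks_zero₂₁]
  have hdetQ : Q.det ≠ 0 := by
    intro h0
    apply mul_ne_zero hA hB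
    rw [← hdetQ0, h0, map_zero]
  have hdetLP : (L * PM).det = (Polynomial.X : Polynomial R) ^ (q * Fintype.card (Fam (famLink F))) * Q.det := by
    rw [hfactor, Matrix.det_mul, Matrix.det_fromBlocks_zero₂₁, Matrix.det_one, one_mul, Matrix.det_smul,
      Matrix.det_one, mul_one, ← pow_mul]
  -- conclude
  intro hM0
  have : (L * PM).det = 0 := by rw [Matrix.det_mul, hdetPM, hM0, map_zero, mul_zero]
  rw [hdetLP] at this
  rcases mul_eq_zero.mp this with hX | hQ'
  · exact absurd hX (pow_ne_zero _ Polynomial.X_ne_zero)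
  · exact hdetQ hQ'
end Peel

/-! ## 2. Induction on the number of vertices -/
section Induction

/-- Over `Fin 0` a set family has at most the member `∅`; the `Δ × Δ` matrix is empty or `(1)`. -/
theorem spMatrix_det_zero_nodes (d : Fin 0 → ℕ) (F : Finset (Finset (Fin 0))) : (spMatrix p 0 d F).det = 1 := by
  classical
  have hsub : ∀ S T : Fam F, S = T := fun S T =>
    Subtype.ext ((Finset.eq_empty_of_isEmpty S.1).trans (Finset.eq_empty_of_isEmpty T.1).symm)
  rcases isEmpty_or_nonempty (Fam F) with hE | ⟨⟨S⟩⟩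
  · exact Matrix.det_isEmpty
  · have hcard : Fintype.card (Fam F) = 1 := Fintype.card_eq_one_iff.mpr ⟨S, fun T => hsub T S⟩
    rw [Matrix.det_eq_elem_of_card_eq_one hcard S, spMatrix, Matrix.of_apply]
    have : S.1 = ∅ := Finset.eq_empty_of_isEmpty S.1
    simp [this, ballWt]

variable [Fact p.Prime]

/-- **`Δ × Δ` is nonsingular for every simplicial complex `Δ`.** For every prime `p`, every `n`, every strictly
increasing digit-exponent map `d` and every down-closed family `F` of subsets of `Fin n`, the Moore matrix
`[η_S ^ (Σ_{c ∈ T} p^{d c})]_{S, T ∈ F}` (rows read members as node sets, columns as digit sets, node `a` ↔ digit `a`)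
has nonzero determinant in `𝔽_p[Y]`. -/
theorem spMatrix_det_ne_zero : ∀ (n : ℕ) (d : Fin n → ℕ) (F : Finset (Finset (Fin n))),
    StrictMono d → IsDownClosedFam F → (spMatrix p n d F).det ≠ 0 := by
  intro n; induction n with
  | zero => intro d F _ _; rw [spMatrix_det_zero_nodes]; exact one_ne_zero
  | succ n ih =>
    intro d F hd hF
    have hd' : StrictMono (d ∘ Fin.succ) := hd.comp (Fin.strictMono_succ)
    exact spMatrix_det_ne_zero_peel p n F hF d (fun c => hd (Fin.succ_pos c))
      (ih _ _ hd' (isDownClosed_famDel hF)) (ih _ _ hd' (isDownClosed_famLink hF))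
end Induction

/-! ## 3. The item's vocabulary: rows and columns through the same lower set -/
section Item
variable [Fact p.Prime]

/-- **F_p for «same lower set on both sides», any enumerations.** If `u, w : Fin r → Finset (Fin h)` are injective with
the same range, and that range is a lower set, then `det [η_{u i}^{Σ_{c∈w j} p^c}] ≠ 0` in `𝔽_p[Y]`. -/
theorem frobDet_ne_zero_samePattern_lowerSet {h r : ℕ} (u w : Fin r → Finset (Fin h))
    (hu : Function.Injective u) (hw : Function.Injective w) (huw : Set.range u = Set.range w)
    (hlow : IsLowerSet (Set.range u)) :
    (Matrix.of fun i j : Fin r =>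
      ((X none + ∑ a ∈ u i, X (some a) : MvPolynomial (Option (Fin h)) (ZMod p))) ^
        (∑ c ∈ w j, p ^ (c : ℕ))).det ≠ 0 := by
  classical
  set F : Finset (Finset (Fin h)) := Finset.univ.image u with hFdef
  have hmemF : ∀ S, S ∈ F ↔ S ∈ Set.range u := by
    intro S; simp [hFdef, Set.mem_range, eq_comm]
  have hF : IsDownClosedFam F := by
    intro S hS T hT
    exact (hmemF T).mpr (hlow (show T ≤ S from hT) ((hmemF S).mp hS))
  -- the canonical matrix in the tree's variables
  set ρ : MvPolynomial (Fin (h + 1)) (ZMod p) →ₐ[ZMod p] MvPolynomial (Option (Fin h)) (ZMod p) :=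
    rename (finSuccEquivLast : Fin (h + 1) ≃ Option (Fin h)) with hρ
  set Nmat : Matrix (Fam F) (Fam F) (MvPolynomial (Option (Fin h)) (ZMod p)) :=
    Matrix.of fun S T : Fam F =>
      ((X none + ∑ a ∈ S.1, X (some a) : MvPolynomial (Option (Fin h)) (ZMod p))) ^ (∑ c ∈ T.1, p ^ (c : ℕ)) with hN
  have hmat : ρ.mapMatrix (spMatrix p h (fun c => (c : ℕ)) F) = Nmat := by
    refine Matrix.ext fun S T => ?_
    simp only [AlgHom.mapMatrix_apply, Matrix.map_apply, spMatrix, hN, Matrix.of_apply, map_pow, ballEta, ballWt,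
      map_add, map_sum, hρ, rename_X, finSuccEquivLast_last, finSuccEquivLast_castSucc]
  have hN0 : Nmat.det ≠ 0 := by
    intro h0
    apply spMatrix_det_ne_zero p h (fun c => (c : ℕ)) F Fin.val_strictMono hF
    apply MvPolynomial.rename_injective _ (finSuccEquivLast : Fin (h + 1) ≃ Option (Fin h)).injective
    have := ρ.map_det (spMatrix p h (fun c => (c : ℕ)) F)
    rw [hmat, h0] at this
    rw [map_zero, ← hρ]
    exact this
  -- the enumerations are bijections onto `Fam F`
  let fu : Fin r → Fam F := fun i => ⟨u i, (hmemF _).mpr ⟨i, rfl⟩⟩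
  let fw : Fin r → Fam F := fun j => ⟨w j, (hmemF _).mpr (huw ▸ ⟨j, rfl⟩)⟩
  have hfu : Function.Bijective fu :=
    ⟨fun i j hij => hu (congrArg Subtype.val hij), fun S => by
      obtain ⟨i, hi⟩ := (hmemF _).mp S.2; exact ⟨i, Subtype.ext hi⟩⟩
  have hfw : Function.Bijective fw :=
    ⟨fun i j hij => hw (congrArg Subtype.val hij), fun S => by
      obtain ⟨j, hj⟩ := (huw ▸ (hmemF _).mp S.2 : S.1 ∈ Set.range w); exact ⟨j, Subtype.ext hj⟩⟩
  set σu := Equiv.ofBijective fu hfu with hσu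
  set σw := Equiv.ofBijective fw hfw with hσw
  set π : Equiv.Perm (Fam F) := σu.symm.trans σw with hπ
  have hsub : (Matrix.of fun i j : Fin r =>
      ((X none + ∑ a ∈ u i, X (some a) : MvPolynomial (Option (Fin h)) (ZMod p))) ^ (∑ c ∈ w j, p ^ (c : ℕ))) =
      (Nmat.submatrix id π).submatrix σu σu := by
    refine Matrix.ext fun i j => ?_
    simp only [Matrix.submatrix_apply, hN, Matrix.of_apply, id, hπ, Equiv.trans_apply, hσu, hσw,
      Equiv.ofBijective_symm_apply_apply, Equiv.ofBijective_apply]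
    rfl
  rw [hsub, Matrix.det_submatrix_equiv_self, Matrix.det_permute']
  rcases Int.units_eq_one_or (Equiv.Perm.sign π) with h1 | h1 <;> simp [h1, hN0]

omit [Fact p.Prime] in
/-- **T1 on the same-lower-set layouts**: a numeric complex additive table with nonzero determinant exists. -/
theorem additiveTable_samePattern_lowerSet {h r : ℕ} (u w : Fin r → Finset (Fin h))
    (hu : Function.Injective u) (hw : Function.Injective w) (huw : Set.range u = Set.range w)
    (hlow : IsLowerSet (Set.range u)) :
    ∃ (ω₀ : Fin h → ℂ) (ω : Fin h → Fin h → ℂ),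
      (Matrix.of fun i j : Fin r => ∏ c ∈ w j, (ω₀ c + ∑ a ∈ u i, ω a c)).det ≠ 0 :=
  haveI : Fact (Nat.Prime 2) := ⟨Nat.prime_two⟩
  exists_table_of_frobenius_char 2 u w (frobDet_ne_zero_samePattern_lowerSet 2 u w hu hw huw hlow)

omit [Fact p.Prime] in
/-- **«SAME SIMPLICIAL COMPLEX ON BOTH SIDES».** For `h ≥ 2` and every injective `u, w` with the same range, that
range a lower set (rows and columns run through the same simplicial complex, in any two orders), the partition minor
is nonsingular at some `f ∈ SmallCircuits ℂ (h+h) 5`. -/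
theorem partitionMinor_hit_samePattern_lowerSet {h r : ℕ} (hh : 2 ≤ h) (u w : Fin r → Finset (Fin h))
    (hu : Function.Injective u) (hw : Function.Injective w) (huw : Set.range u = Set.range w)
    (hlow : IsLowerSet (Set.range u)) :
    ∃ f ∈ SmallCircuits ℂ (h + h) 5,
      (Matrix.of fun i j : Fin r => MvPolynomial.coeff
        (∑ a ∈ u i, Finsupp.single (Fin.castAdd h a) 1 +
          ∑ c ∈ w j, Finsupp.single (Fin.natAdd h c) 1) f).det ≠ 0 :=
  haveI : Fact (Nat.Prime 2) := ⟨Nat.prime_two⟩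
  partitionMinor_hit_of_frobenius_char 2 hh u w (frobDet_ne_zero_samePattern_lowerSet 2 u w hu hw huw hlow)

/-- **Relabeled copies.** Rows through a lower set `Δ` and columns through `π(Δ)` for a permutation `π` of the
coordinates (any two orders): the Moore determinant is nonzero (rename the node variables by `π`). -/
theorem frobDet_ne_zero_samePattern_lowerSet_perm {h r : ℕ} (π : Equiv.Perm (Fin h))
    (u w : Fin r → Finset (Fin h)) (hu : Function.Injective u) (hw : Function.Injective w)
    (hlow : IsLowerSet (Set.range u))
    (huw : Set.range w = Set.range fun i => (u i).map π.toEmbedding) :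
    (Matrix.of fun i j : Fin r =>
      ((X none + ∑ a ∈ u i, X (some a) : MvPolynomial (Option (Fin h)) (ZMod p))) ^
        (∑ c ∈ w j, p ^ (c : ℕ))).det ≠ 0 := by
  classical
  set u' : Fin r → Finset (Fin h) := fun i => (u i).map π.toEmbedding with hu'
  have hu'inj : Function.Injective u' := fun i j hij => hu (Finset.map_injective π.toEmbedding hij)
  have hlow' : IsLowerSet (Set.range u') := by
    rintro U T hTU ⟨i, rfl⟩
    have hT : T.map π.symm.toEmbedding ≤ u i := by
      intro x hx
      obtain ⟨y, hy, rfl⟩ := Finset.mem_map.mp hx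
      have := hTU hy
      rw [hu'] at this
      obtain ⟨z, hz, hzy⟩ := Finset.mem_map.mp this
      simp only [Equiv.toEmbedding_apply] at hzy ⊢
      rw [← hzy, Equiv.symm_apply_apply]; exact hz
    obtain ⟨k, hk⟩ := hlow hT ⟨i, rfl⟩
    refine ⟨k, ?_⟩
    show (u k).map π.toEmbedding = T
    rw [hk, Finset.map_map]
    convert Finset.map_refl (s := T) using 2
    ext x; simp
  have key := frobDet_ne_zero_samePattern_lowerSet p u' w hu'inj hw huw.symm hlow'
  -- rename the node variables by `π`
  set ρ : MvPolynomial (Option (Fin h)) (ZMod p) →ₐ[ZMod p] MvPolynomial (Option (Fin h)) (ZMod p) :=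
    rename (Option.map π) with hρ
  have hmat : ρ.mapMatrix (Matrix.of fun i j : Fin r =>
      ((X none + ∑ a ∈ u i, X (some a) : MvPolynomial (Option (Fin h)) (ZMod p))) ^ (∑ c ∈ w j, p ^ (c : ℕ))) =
      Matrix.of fun i j : Fin r =>
        ((X none + ∑ a ∈ u' i, X (some a) : MvPolynomial (Option (Fin h)) (ZMod p))) ^ (∑ c ∈ w j, p ^ (c : ℕ)) := by
    refine Matrix.ext fun i j => ?_
    simp only [AlgHom.mapMatrix_apply, Matrix.map_apply, Matrix.of_apply, map_pow, map_add, map_sum, hρ, rename_X,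
      Option.map_none, Option.map_some, hu', Finset.sum_map, Equiv.toEmbedding_apply]
  intro h0
  apply key
  rw [← hmat, ← AlgHom.map_det, h0, map_zero]

omit [Fact p.Prime] in
/-- **Rows through `Δ`, columns through a relabeled copy `π(Δ)`** (`Δ` a lower set, `π` any permutation of the `h`
coordinates, any two orders): hit inside `SmallCircuits ℂ (h+h) 5`, `h ≥ 2`. -/
theorem partitionMinor_hit_samePattern_lowerSet_perm {h r : ℕ} (hh : 2 ≤ h) (π : Equiv.Perm (Fin h))
    (u w : Fin r → Finset (Fin h)) (hu : Function.Injective u) (hw : Function.Injective w)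
    (hlow : IsLowerSet (Set.range u)) (huw : Set.range w = Set.range fun i => (u i).map π.toEmbedding) :
    ∃ f ∈ SmallCircuits ℂ (h + h) 5,
      (Matrix.of fun i j : Fin r => MvPolynomial.coeff
        (∑ a ∈ u i, Finsupp.single (Fin.castAdd h a) 1 +
          ∑ c ∈ w j, Finsupp.single (Fin.natAdd h c) 1) f).det ≠ 0 :=
  haveI : Fact (Nat.Prime 2) := ⟨Nat.prime_two⟩
  partitionMinor_hit_of_frobenius_char 2 hh u w
    (frobDet_ne_zero_samePattern_lowerSet_perm 2 π u w hu hw hlow huw)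
end Item

end

end Summit.ValiantsHypothesis.ValiantsHypothesis.Theorems.BarrierLever.FrobeniusDoor
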